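import Mathlib
import HarnessLib
import Summits.NavierStokesRegularity.NavierStokesRegularity.Theses.LocalLevelHeadDoor
import Summits.NavierStokesRegularity.NavierStokesRegularity.Theorems.LocalLevelHeadDoorLocalPointZoomSimilarityHead
import Summits.NavierStokesRegularity.NavierStokesRegularity.Theorems.LocalLevelHeadDoorLevelHeadSpread
import Summits.NavierStokesRegularity.NavierStokesRegularity.Theorems.LocalLevelHeadDoorLevelHeadProfileRigidity

/-!
# `LocalLevelHeadDoor.Target` (item stmt-NavierStokesRegularity-28094) — the LEVEL-HEAD DOOR, closed BY NAME

The route's planner-authored deciding theorem `Theses.LocalLevelHeadDoor.closes` applied to the three PROVED items: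
28097 `localLevelHeadDoor_localPointZoomSimilarityHead_proof`, 28096 `localLevelHeadDoor_levelHeadSpread_proof`,
28095 `localLevelHeadDoor_levelHeadProfileRigidity_proof`.

HONEST FRAMING: the door is a CONDITIONAL regularity criterion on hypothetical locally space–time Type-I blow-ups (a level
similarity head on some window ⇒ backward bounded) — an N0 door rung («N0-LocalTubeDoorLevelHead»), vacuous iff such blow-ups do
not exist; it is NOT 0056 `NoTypeII`, not the summit; Navier–Stokes regularity is NOT proved.  Seat ns-sz-p1 g5 (#237 (2)).
-/

noncomputable section

set_option linter.dupNamespace false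

namespace Summit.NavierStokesRegularity.NavierStokesRegularity.Theorems

/-- **Item stmt-NavierStokesRegularity-28094** (`LocalLevelHeadDoor.Target`): the level-head door. [folklore] -/
theorem localLevelHeadDoor_target_proof :
    Summit.NavierStokesRegularity.NavierStokesRegularity.Theses.LocalLevelHeadDoor.Target :=
  Summit.NavierStokesRegularity.NavierStokesRegularity.Theses.LocalLevelHeadDoor.closes
    localLevelHeadDoor_localPointZoomSimilarityHead_proof localLevelHeadDoor_levelHeadSpread_proof
    localLevelHeadDoor_levelHeadProfileRigidity_proof

end Summit.NavierStokesRegularity.NavierStokesRegularity.Theorems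

end
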